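import Summits.AtomisticToContinuum.BoseEinsteinCondensation.Theorems.BECGroundStateSOSPeriodicIRBoundDefs
import Summits.AtomisticToContinuum.BoseEinsteinCondensation.Theorems.BECGroundStateSOSPeriodicIRBoundWFDefs
import Summits.AtomisticToContinuum.BoseEinsteinCondensation.Theorems.BECGroundStateSOSPeriodicIRBoundWFVariational
import Summits.AtomisticToContinuum.BoseEinsteinCondensation.Theorems.BECGroundStateSOSPeriodicIRBoundWFKinematics
import Summits.AtomisticToContinuum.BoseEinsteinCondensation.Theorems.BECGroundStateSOSPeriodicIRBoundWFFormBounds2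
import Summits.AtomisticToContinuum.BoseEinsteinCondensation.Theorems.BECGroundStateSOSPeriodicIRBoundWFPolar
import Summits.AtomisticToContinuum.BoseEinsteinCondensation.Theorems.BECGroundStateSOSPeriodicIRBoundWFHeartGlue
import Summits.AtomisticToContinuum.BoseEinsteinCondensation.Theorems.BECGroundStateSOSPeriodicIRBoundWFComFourier
import Summits.AtomisticToContinuum.BoseEinsteinCondensation.Theorems.BECGroundStateSOSPeriodicIRBoundWFComGap
import Summits.AtomisticToContinuum.BoseEinsteinCondensation.Theorems.BECGroundStateSOSPeriodicIRBoundWFHeartKin2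
import Summits.AtomisticToContinuum.BoseEinsteinCondensation.Theorems.PeriodicIRBound.Negative.GroundOccupation
import Literature.MathematicalPhysics.QuantumManyBody.PeriodicBoseGasMomentumSector
import Literature.MathematicalPhysics.QuantumManyBody.TorusFockLayer
import Literature.MathematicalPhysics.QuantumManyBody.PeriodicFormDomain
import HarnessLib

/-! # Crux `PeriodicIRBound` (stmt-AtomisticToContinuum-3972), line `linear-ph-floor-wagner`, stub 5b `stub_wagnerFeynman` — Assembly
The assembly: `WagnerFeynmanWith v 2` for every integrable admissible `v` with the zero-momentum gap, hence the stub `stub_wagnerFeynman : WagnerFeynmanBound` of the line `linear-ph-floor-wagner`. -/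

/-!
# Stub 5b (`stub_wagnerFeynman`), §H: the assembly — `WagnerFeynmanWith v 2` for integrable admissible `v` with the
-/

noncomputable section

open scoped BigOperators ENNReal ComplexConjugate Topology
open Filter MeasureTheory

namespace Summit.AtomisticToContinuum.BoseEinsteinCondensation.Cruxes.PeriodicIRBound.LinearPhFloorWagner.WF

open Literature.MathematicalPhysics.QuantumManyBody.BoseGas
open Summit.AtomisticToContinuum.BoseEinsteinCondensation.Theorems.PeriodicIRBound.Negative (groundOccupation)

variable {M m n : ℕ} {L : ℝ}

/-! ### Small conversions -/

/-- `Re⟨Φ, n̂Φ⟩ = N_k(Φ)`. -/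
theorem innerRe_numOp (hL : 0 < L) (k : Fin 3 → ℤ) {Φ : Config (n + 1) → ℂ} (hΦ : IsCore L Φ) :
    innerRe L Φ (modeCr (planeWaveMode L k) (modeAn L (planeWaveMode L k) Φ)) =
      (cellOccupation (n + 1) L (planeWaveMode L k) Φ).toReal := by
  unfold innerRe
  have h := integral_conj_numOp_mul hL k hΦ
  have hconj : (∫ X in cellN (n + 1) L, conj (Φ X) * modeCr (planeWaveMode L k) (modeAn L (planeWaveMode L k) Φ) X) =
      conj (∫ X in cellN (n + 1) L, conj (modeCr (planeWaveMode L k) (modeAn L (planeWaveMode L k) Φ) X) * Φ X) := by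
    rw [← integral_conj]
    refine integral_congr_ae (Eventually.of_forall fun X => ?_)
    simp only [map_mul, Complex.conj_conj, mul_comm]
  rw [hconj, h, Complex.conj_ofReal, Complex.ofReal_re]

/-- `(a^{1/2} + b^{1/2})² = ofReal ((√a + √b)²)` for finite `a, b`. -/
private theorem rpow_half_add_sq_eq {a b : ℝ≥0∞} (ha : a ≠ ⊤) (hb : b ≠ ⊤) :
    (a ^ (1 / 2 : ℝ) + b ^ (1 / 2 : ℝ)) ^ (2 : ℝ) =
      ENNReal.ofReal ((Real.sqrt a.toReal + Real.sqrt b.toReal) ^ 2) := by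
  have ha' : a ^ (1 / 2 : ℝ) ≠ ⊤ := ENNReal.rpow_ne_top_of_nonneg (by norm_num) ha
  have hb' : b ^ (1 / 2 : ℝ) ≠ ⊤ := ENNReal.rpow_ne_top_of_nonneg (by norm_num) hb
  have hs : a ^ (1 / 2 : ℝ) + b ^ (1 / 2 : ℝ) ≠ ⊤ := ENNReal.add_ne_top.2 ⟨ha', hb'⟩
  rw [← ENNReal.ofReal_toReal (ENNReal.rpow_ne_top_of_nonneg (by norm_num) hs), ← ENNReal.toReal_rpow,
    ENNReal.toReal_add ha' hb', ← ENNReal.toReal_rpow, ← ENNReal.toReal_rpow, ← Real.sqrt_eq_rpow,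
    ← Real.sqrt_eq_rpow, Real.rpow_two]

/-- `toReal` of a coefficient `(m + 1 : ℝ≥0∞)`. -/
private theorem toReal_natCast_add_one (m : ℕ) : ((m : ℝ≥0∞) + 1).toReal = (m : ℝ) + 1 := by
  rw [ENNReal.toReal_add (ENNReal.natCast_ne_top m) ENNReal.one_ne_top, ENNReal.toReal_natCast,
    ENNReal.toReal_one]

/-- `(m + 1 : ℝ≥0∞) ≠ ⊤`. -/
private theorem natCast_add_one_ne_top (m : ℕ) : ((m : ℝ≥0∞) + 1) ≠ ⊤ :=
  ENNReal.add_ne_top.2 ⟨ENNReal.natCast_ne_top m, ENNReal.one_ne_top⟩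

/-! ### The assembly -/

/-- **`WagnerFeynmanWith v 2`** for every integrable admissible `v` with the zero-momentum gap (the stub `stub_wagnerFeynman` with
`A = 2`, names inlined). -/
theorem wagnerFeynmanWith_two (v : ℝ → ℝ≥0∞) (hv : IsRepulsiveFiniteRange v) (hint : (∫⁻ x : Space, v ‖x‖) ≠ ⊤)
    (hgap : ∀ (N : ℕ) (L : ℝ), 0 < L → ∀ q : Space, q ≠ 0 →
      periodicGroundStateEnergy v N L < momentumSectorEnergy v N L q) :
    ∀ (N : ℕ) (L : ℝ), 2 ≤ N → 0 < L → periodicGroundStateEnergy v N L ≠ ⊤ →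
    ∀ k : Fin 3 → ℤ, k ≠ 0 → ∀ θ : ℝ, 0 ≤ θ →
      2 * periodicGroundStateEnergy v N L + ENNReal.ofReal θ ≤
          momentumSectorEnergy v (N + 1) L (latticeVec (2 * Real.pi / L) k) +
            momentumSectorEnergy v (N - 1) L (latticeVec (2 * Real.pi / L) k) →
      groundOccupation v N L k * ENNReal.ofReal θ ≤
        ENNReal.ofReal (2 * (‖latticeVec (2 * Real.pi / L) k‖ ^ 2 +
          N * (∫⁻ x : Space, v ‖x‖).toReal / L ^ 3)) := by
  intro N L hN hL hE k hk θ hθ hfloor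
  obtain ⟨n, rfl⟩ : ∃ n, N = n + 2 := ⟨N - 2, by omega⟩
  have hw : Measurable v := hv.1
  -- `θ = 0` is trivial
  rcases hθ.eq_or_lt with hθ0 | hθpos
  · rw [← hθ0, ENNReal.ofReal_zero, mul_zero]; exact bot_le
  -- notation
  set E₀ : ℝ≥0∞ := periodicGroundStateEnergy v (n + 2) L with hE₀
  set p : Space := latticeVec (2 * Real.pi / L) k with hp
  set V₁ : ℝ := (∫⁻ x : Space, v ‖x‖).toReal with hV₁
  have hV₁0 : 0 ≤ V₁ := ENNReal.toReal_nonneg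
  set D : ℝ := ‖p‖ ^ 2 + 2 * (n + 2) * V₁ / L ^ 3 with hD
  have hD0 : 0 ≤ D := by positivity
  have hNsub : n + 2 - 1 = n + 1 := by omega
  rw [hNsub] at hfloor
  -- target in the form `γ ≤ ofReal (D'/θ)`; we prove the stronger `γ ≤ ofReal (D/θ)`
  have hDle : D ≤ 2 * (‖p‖ ^ 2 + (n + 2 : ℕ) * V₁ / L ^ 3) := by
    push_cast
    have h1 : 0 ≤ ‖p‖ ^ 2 := by positivity
    have h2 : D = ‖p‖ ^ 2 + 2 * ((n + 2) * V₁ / L ^ 3) := by rw [hD]; ring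
    rw [h2]
    linarith
  suffices hmain : groundOccupation v (n + 2) L k ≤ ENNReal.ofReal (D / θ) by
    calc groundOccupation v (n + 2) L k * ENNReal.ofReal θ
        ≤ ENNReal.ofReal (D / θ) * ENNReal.ofReal θ := mul_le_mul_left hmain _
      _ = ENNReal.ofReal D := by rw [← ENNReal.ofReal_mul (by positivity), div_mul_cancel₀ D hθpos.ne']
      _ ≤ _ := ENNReal.ofReal_le_ofReal hDle
  -- the gap of the orthogonal complement
  obtain ⟨g, hg0, hgapΨ⟩ := exists_gap_comProj hL hw hint (M := n + 2) (by omega) hE (hgap (n + 2) L hL)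
  set gm : ℝ≥0∞ := min g 1 with hgm
  have hgm0 : 0 < gm := lt_min hg0 one_pos
  have hgmtop : gm ≠ ⊤ := ne_top_of_le_ne_top ENNReal.one_ne_top (min_le_right _ _)
  set gR : ℝ := gm.toReal with hgR
  have hgR0 : 0 < gR := ENNReal.toReal_pos hgm0.ne' hgmtop
  -- the a priori constant for the cross-term energy `qform (n̂Φ)`
  set cB : ℝ := ‖p‖ ^ 2 + (n + 1) * V₁ / L ^ 3 with hcB
  have hcB0 : 0 ≤ cB := by positivity
  set Kb : ℝ := (n + 2) * ((n + 2) * (E₀.toReal + 1) + cB * (n + 2)) with hKb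
  have hKb0 : 0 ≤ Kb := by positivity
  -- it suffices to beat `(D + ε)/θ` for every `ε > 0`
  refine ennreal_le_of_forall_pos (by positivity) fun ε hε => ?_
  rw [show D / θ + ε = (D + ε * θ) / θ by field_simp]
  obtain ⟨δ₀, hδ₀, hslack⟩ := exists_slack hD0 hθpos (mul_pos hε hθpos) hKb0 (c := (n + 2) / gR) (by positivity)
  -- the slack actually used
  set δ : ℝ := min δ₀ (gR / 2) with hδdef
  have hδpos : 0 < δ := lt_min hδ₀ (by positivity)
  have hδle : δ ≤ δ₀ := min_le_left _ _
  have hδg : δ ≤ gR / 2 := min_le_right _ _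
  have hslackδ := hslack δ hδpos hδle
  set δE : ℝ≥0∞ := ENNReal.ofReal δ with hδE
  have hδE0 : 0 < δE := ENNReal.ofReal_pos.2 hδpos
  -- `γ ≤ sup over δ-near-minimisers`
  refine (iInf₂_le δE hδE0).trans (iSup₂_le fun Ψ hΨ => ?_)
  -- ===== the per-state bound =====
  -- the state, its c.o.m. projection `Φ` and the orthogonal part `Ψp`
  set ψ : Config (n + 2) → ℂ := Ψ.ψ with hψdef
  have hψc : IsCore L ψ := isCore_trialState Ψ
  have hψ1 : normSq L ψ = 1 := Ψ.norm_eq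
  have hψE : qform v L ψ ≤ E₀ + δE := hΨ
  set Φ : Config (n + 2) → ℂ := comProj L ψ with hΦdef
  have hΦcm : IsCore L Φ ∧ HasTotalMomentum 0 Φ := isCore_comProj hL hψc
  obtain ⟨hΦc, hΦ0⟩ := hΦcm
  set Ψp : Config (n + 2) → ℂ := fun X => ψ X - Φ X with hΨpdef
  have hΨpc : IsCore L Ψp := isCore_sub' hψc hΦc
  have hPy : normSq L ψ = normSq L Φ + normSq L Ψp ∧ qform v L ψ = qform v L Φ + qform v L Ψp :=
    comProj_pythagoras hL hw hψc
  obtain ⟨hPyN, hPyQ⟩ := hPy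
  have hgapP : (E₀ + g) * normSq L Ψp ≤ qform v L Ψp := hgapΨ ψ hψc
  have hA1Φ : E₀ * normSq L Φ ≤ qform v L Φ := groundStateEnergy_mul_normSq_le hL hw hΦc
  -- finiteness
  have hδEtop : δE ≠ ⊤ := ENNReal.ofReal_ne_top
  have hEδtop : E₀ + δE ≠ ⊤ := ENNReal.add_ne_top.2 ⟨hE, hδEtop⟩
  have hψEtop : qform v L ψ ≠ ⊤ := ne_top_of_le_ne_top hEδtop hψE
  have hΦEle : qform v L Φ ≤ qform v L ψ := by rw [hPyQ]; exact le_self_add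
  have hΨpEle : qform v L Ψp ≤ qform v L ψ := by rw [hPyQ]; exact le_add_self
  have hΦEtop : qform v L Φ ≠ ⊤ := ne_top_of_le_ne_top hψEtop hΦEle
  have hΨpEtop : qform v L Ψp ≠ ⊤ := ne_top_of_le_ne_top hψEtop hΨpEle
  have hnΦle : normSq L Φ ≤ 1 := by rw [← hψ1, hPyN]; exact le_self_add
  have hnPle : normSq L Ψp ≤ 1 := by rw [← hψ1, hPyN]; exact le_add_self
  have hnΦtop : normSq L Φ ≠ ⊤ := ne_top_of_le_ne_top ENNReal.one_ne_top hnΦle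
  have hnPtop : normSq L Ψp ≠ ⊤ := ne_top_of_le_ne_top ENNReal.one_ne_top hnPle
  -- reals, level one: the near-minimiser splits
  set e0 : ℝ := E₀.toReal with he0
  set nΦ : ℝ := (normSq L Φ).toReal with hnΦ
  set nP : ℝ := (normSq L Ψp).toReal with hnP
  set qΦ : ℝ := (qform v L Φ).toReal with hqΦ
  set qP : ℝ := (qform v L Ψp).toReal with hqP
  have he0_0 : 0 ≤ e0 := ENNReal.toReal_nonneg
  have hnΦ0 : 0 ≤ nΦ := ENNReal.toReal_nonneg
  have hnP0 : 0 ≤ nP := ENNReal.toReal_nonneg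
  have hqP0 : 0 ≤ qP := ENNReal.toReal_nonneg
  have hgR1 : gR ≤ 1 := by
    have := ENNReal.toReal_mono ENNReal.one_ne_top (min_le_right g 1)
    rwa [ENNReal.toReal_one] at this
  have hδ1 : δ ≤ 1 := by linarith
  have hsumN : nΦ + nP = 1 := by
    have h := congrArg ENNReal.toReal hPyN
    rw [hψ1, ENNReal.toReal_add hnΦtop hnPtop, ENNReal.toReal_one] at h
    linarith
  have hnΦ1 : nΦ ≤ 1 := by linarith
  have hsumQ : qΦ + qP ≤ e0 + δ := by
    have h := ENNReal.toReal_mono hEδtop hψE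
    rw [hPyQ, ENNReal.toReal_add hΦEtop hΨpEtop, ENNReal.toReal_add hE hδEtop,
      ENNReal.toReal_ofReal hδpos.le] at h
    exact h
  have hA1r : e0 * nΦ ≤ qΦ := by
    have h := ENNReal.toReal_mono hΦEtop hA1Φ
    rwa [ENNReal.toReal_mul] at h
  have hgapr : (e0 + gR) * nP ≤ qP := by
    have h1 : (E₀ + gm) * normSq L Ψp ≤ qform v L Ψp := by
      refine le_trans ?_ hgapP
      gcongr
      exact min_le_left g 1
    have h := ENNReal.toReal_mono hΨpEtop h1
    rwa [ENNReal.toReal_mul, ENNReal.toReal_add hE hgmtop] at h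
  have he0split : e0 = e0 * nΦ + e0 * nP := by rw [← mul_add, hsumN, mul_one]
  have hgsplit : (e0 + gR) * nP = e0 * nP + gR * nP := by ring
  have hnPδ : gR * nP ≤ δ := by linarith
  have hgnP0 : 0 ≤ gR * nP := by positivity
  have h5 : qΦ ≤ e0 * nΦ + δ := by linarith
  -- the excitation `a_k Φ`, the particle state `a_k† Φ`, and `n̂ Φ`
  set aΦ : Config (n + 1) → ℂ := modeAn L (planeWaveMode L k) Φ with haΦ
  set cΦ : Config (n + 2 + 1) → ℂ := modeCr (planeWaveMode L k) Φ with hcΦ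
  set NΦ : Config (n + 2) → ℂ := modeCr (planeWaveMode L k) aΦ with hNΦ
  have haΦc : IsCore L aΦ := isCore_modeAn hL k hΦc
  have hcΦc : IsCore L cΦ := isCore_modeCr hL k hΦc
  have hNΦc : IsCore L NΦ := isCore_modeCr hL k haΦc
  have haΦm : HasTotalMomentum (-p) aΦ := hasTotalMomentum_modeAn hL k hΦc hΦ0
  have hcΦm : HasTotalMomentum p cΦ := hasTotalMomentum_modeCr k hΦ0
  have hB5' : ∀ f : Config (n + 2) → ℂ,
      cellOccupation (n + 2) L (planeWaveMode L k) f = normSq L (modeAn L (planeWaveMode L k) f) :=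
    fun f => (normSq_modeAn hL k f).symm
  set νE : ℝ≥0∞ := cellOccupation (n + 2) L (planeWaveMode L k) Φ with hνE
  set mE : ℝ≥0∞ := cellOccupation (n + 2) L (planeWaveMode L k) Ψp with hmE
  have hB5 : normSq L aΦ = νE := (hB5' Φ).symm
  have hB6 : normSq L cΦ = normSq L Φ + νE := normSq_modeCr hL k hΦc
  have hνle : νE ≤ ((n + 2 : ℕ) : ℝ≥0∞) * normSq L Φ :=
    cellOccupation_le_mul_normSq hL k hΦc.contDiff.continuous
  have hmle : mE ≤ ((n + 2 : ℕ) : ℝ≥0∞) * normSq L Ψp :=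
    cellOccupation_le_mul_normSq hL k hΨpc.contDiff.continuous
  have hνtop : νE ≠ ⊤ := ne_top_of_le_ne_top (ENNReal.mul_ne_top (ENNReal.natCast_ne_top _) hnΦtop) hνle
  have hmtop : mE ≠ ⊤ := ne_top_of_le_ne_top (ENNReal.mul_ne_top (ENNReal.natCast_ne_top _) hnPtop) hmle
  set ν : ℝ := νE.toReal with hν
  set m : ℝ := mE.toReal with hm
  have hν0 : 0 ≤ ν := ENNReal.toReal_nonneg
  have hm0 : 0 ≤ m := ENNReal.toReal_nonneg
  have hνr : ν ≤ (n + 2) * nΦ := by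
    have h := ENNReal.toReal_mono (ENNReal.mul_ne_top (ENNReal.natCast_ne_top _) hnΦtop) hνle
    rw [ENNReal.toReal_mul, ENNReal.toReal_natCast] at h
    push_cast at h
    exact h
  have hmr : m ≤ (n + 2) / gR * δ := by
    have h := ENNReal.toReal_mono (ENNReal.mul_ne_top (ENNReal.natCast_ne_top _) hnPtop) hmle
    rw [ENNReal.toReal_mul, ENNReal.toReal_natCast] at h
    push_cast at h
    have h2 : nP ≤ δ / gR := by rw [le_div_iff₀ hgR0]; linarith
    calc m ≤ (n + 2) * nP := h
      _ ≤ (n + 2) * (δ / gR) := by gcongr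
      _ = (n + 2) / gR * δ := by ring
  -- Minkowski: `n_k(ψ) ≤ (√ν + √m)²`
  have hocc : cellOccupation (n + 2) L (planeWaveMode L k) ψ ≤ (νE ^ (1 / 2 : ℝ) + mE ^ (1 / 2 : ℝ)) ^ (2 : ℝ) := by
    have h := modeAn_add_real_smul L k hΦc.contDiff.continuous hΨpc.contDiff.continuous 1
    have hψeq : (fun X => Φ X + ((1 : ℝ) : ℂ) * Ψp X) = ψ := by
      funext X; simp only [hΨpdef]; push_cast; ring
    rw [hψeq] at h
    rw [hB5' ψ, hmE, hB5' Ψp, ← hB5, h]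
    simp only [Complex.ofReal_one, one_mul]
    exact normSq_add_le_sq L haΦc.contDiff.continuous.measurable
      (isCore_modeAn hL k hΨpc).contDiff.continuous.measurable
  -- a priori energy bounds for `a_k Φ`, `a_k† Φ`, `n̂ Φ`
  have haΦE := qform_modeAn_le hL hw k hΦc
  have haΦEtop : qform v L aΦ ≠ ⊤ := ne_top_of_le_ne_top (ENNReal.mul_ne_top (natCast_add_one_ne_top _) hΦEtop) haΦE
  have hcΦE := qform_modeCr_le hL hw hint k hΦc
  have hcΦEtop : qform v L cΦ ≠ ⊤ :=
    ne_top_of_le_ne_top (ENNReal.mul_ne_top (natCast_add_one_ne_top _) (ENNReal.add_ne_top.2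
      ⟨hΦEtop, ENNReal.mul_ne_top ENNReal.ofReal_ne_top hnΦtop⟩)) hcΦE
  have hNΦE := qform_modeCr_le hL hw hint k haΦc
  have hNΦEtop : qform v L NΦ ≠ ⊤ :=
    ne_top_of_le_ne_top (ENNReal.mul_ne_top (natCast_add_one_ne_top _) (ENNReal.add_ne_top.2
      ⟨haΦEtop, ENNReal.mul_ne_top ENNReal.ofReal_ne_top (hB5 ▸ hνtop)⟩)) hNΦE
  set qa : ℝ := (qform v L aΦ).toReal with hqa
  set qc : ℝ := (qform v L cΦ).toReal with hqc
  set K : ℝ := (qform v L NΦ).toReal with hK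
  have hqa0 : 0 ≤ qa := ENNReal.toReal_nonneg
  have hK0 : 0 ≤ K := ENNReal.toReal_nonneg
  have hqar : qa ≤ (n + 2) * qΦ := by
    have h := ENNReal.toReal_mono (ENNReal.mul_ne_top (natCast_add_one_ne_top _) hΦEtop) haΦE
    rw [ENNReal.toReal_mul, toReal_natCast_add_one] at h
    push_cast at h
    linarith
  have hKr : K ≤ (n + 2) * (qa + cB * ν) := by
    have h := ENNReal.toReal_mono (ENNReal.mul_ne_top (natCast_add_one_ne_top _) (ENNReal.add_ne_top.2
      ⟨haΦEtop, ENNReal.mul_ne_top ENNReal.ofReal_ne_top (hB5 ▸ hνtop)⟩)) hNΦE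
    rw [ENNReal.toReal_mul, toReal_natCast_add_one, ENNReal.toReal_add haΦEtop
      (ENNReal.mul_ne_top ENNReal.ofReal_ne_top (hB5 ▸ hνtop)), ENNReal.toReal_mul,
      ENNReal.toReal_ofReal (by positivity), hB5] at h
    push_cast at h
    have hc : ‖p‖ ^ 2 + (↑n + 1) * V₁ / L ^ 3 = cB := by rw [hcB]
    rw [hc] at h
    linarith
  have hKle : K ≤ Kb := by
    have h1 : qa ≤ (n + 2) * (e0 + 1) := by
      have he : e0 * nΦ ≤ e0 * 1 := mul_le_mul_of_nonneg_left hnΦ1 he0_0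
      have hq1 : qΦ ≤ e0 + 1 := by linarith only [h5, he, hδ1, mul_one e0]
      have hq2 : (n + 2 : ℝ) * qΦ ≤ (n + 2) * (e0 + 1) := mul_le_mul_of_nonneg_left hq1 (by positivity)
      exact hqar.trans hq2
    have h2 : ν ≤ n + 2 := by
      have hh : (n + 2 : ℝ) * nΦ ≤ (n + 2) * 1 := mul_le_mul_of_nonneg_left hnΦ1 (by positivity)
      linarith only [hνr, hh, mul_one ((n : ℝ) + 2)]
    have h3 : cB * ν ≤ cB * (n + 2) := mul_le_mul_of_nonneg_left h2 hcB0
    calc K ≤ (n + 2) * (qa + cB * ν) := hKr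
      _ ≤ (n + 2) * ((n + 2) * (e0 + 1) + cB * (n + 2)) := by gcongr
      _ = Kb := by rw [hKb]
  -- the moment bound `ν ≤ (D + δ + 2√δ√Kb)/θ`
  have hνbound : ν ≤ (D + δ + 2 * (Real.sqrt δ * Real.sqrt Kb)) / θ := by
    rcases eq_or_ne νE 0 with hν00 | hν00
    · have : ν = 0 := by rw [hν, hν00, ENNReal.toReal_zero]
      rw [this]; positivity
    -- sector energies
    set E1 : ℝ≥0∞ := momentumSectorEnergy v (n + 1) L p with hE1
    set E3 : ℝ≥0∞ := momentumSectorEnergy v (n + 2 + 1) L p with hE3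
    have hA2a : E1 * νE ≤ qform v L aΦ := by
      rw [hE1, ← momentumSectorEnergy_neg, ← hB5]
      exact momentumSectorEnergy_mul_normSq_le hL v haΦc haΦm
    have hA2c : E3 * (normSq L Φ + νE) ≤ qform v L cΦ := by
      rw [← hB6]; exact momentumSectorEnergy_mul_normSq_le hL v hcΦc hcΦm
    have h7E : E₀ ≤ E3 :=
      (periodicGroundStateEnergy_le_succ hL hw (n + 2)).trans
        (periodicGroundStateEnergy_le_momentumSectorEnergy v _ L p)
    have hE1top : E1 ≠ ⊤ := by
      intro htop
      rw [htop, ENNReal.top_mul hν00, top_le_iff] at hA2a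
      exact haΦEtop hA2a
    have hnν0 : normSq L Φ + νE ≠ 0 := by
      intro h0; exact hν00 (le_zero_iff.1 ((le_add_self).trans h0.le))
    have hE3top : E3 ≠ ⊤ := by
      intro htop
      rw [htop, ENNReal.top_mul hnν0, top_le_iff] at hA2c
      exact hcΦEtop hA2c
    set e1 : ℝ := E1.toReal with he1
    set e3 : ℝ := E3.toReal with he3
    set B : ℝ := formRe v L Φ NΦ with hB
    have h1 : e1 * ν ≤ qa := by
      have h := ENNReal.toReal_mono haΦEtop hA2a
      rwa [ENNReal.toReal_mul] at h
    have h2 : e3 * (nΦ + ν) ≤ qc := by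
      have h := ENNReal.toReal_mono hcΦEtop hA2c
      rwa [ENNReal.toReal_mul, ENNReal.toReal_add hnΦtop hνtop] at h
    have h3 : qa + qc ≤ D * nΦ + qΦ + 2 * B := wagnerFeynman_form_le hL hw hint hk hΦc hΦEtop
    have h4 : |B - e0 * ν| ≤ Real.sqrt δ * Real.sqrt K := by
      have h := abs_formRe_sub_le hL hw hΦc hNΦc hΦEtop hNΦEtop hE hδpos.le h5
      have hi : innerRe L Φ NΦ = ν := innerRe_numOp hL k hΦc
      rwa [hi] at h
    have h6 : 2 * e0 + θ ≤ e3 + e1 := by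
      have h := ENNReal.toReal_mono (ENNReal.add_ne_top.2 ⟨hE3top, hE1top⟩) hfloor
      rwa [ENNReal.toReal_add (ENNReal.mul_ne_top ENNReal.ofNat_ne_top hE) ENNReal.ofReal_ne_top,
        ENNReal.toReal_add hE3top hE1top, ENNReal.toReal_mul, ENNReal.toReal_ofReal hθ,
        ENNReal.toReal_ofNat] at h
    have h7 : e0 ≤ e3 := ENNReal.toReal_mono hE3top h7E
    have hcore := wf_real_core hν0 hnΦ0 hnΦ1 hθ hδpos.le hK0 hD0 he0_0 h1 h2 h3 h4 h5 h6 h7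
    have hcore' : θ * ν ≤ D + δ + 2 * (Real.sqrt δ * Real.sqrt Kb) :=
      hcore.trans (by gcongr)
    rw [le_div_iff₀ hθpos]
    linarith
  -- conclusion
  calc cellOccupation (n + 2) L (planeWaveMode L k) ψ
      ≤ (νE ^ (1 / 2 : ℝ) + mE ^ (1 / 2 : ℝ)) ^ (2 : ℝ) := hocc
    _ = ENNReal.ofReal ((Real.sqrt ν + Real.sqrt m) ^ 2) := rpow_half_add_sq_eq hνtop hmtop
    _ ≤ ENNReal.ofReal ((D + ε * θ) / θ) := by
      refine ENNReal.ofReal_le_ofReal (le_trans ?_ hslackδ)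
      have hX := Real.sqrt_le_sqrt hνbound
      have hY := Real.sqrt_le_sqrt hmr
      exact pow_le_pow_left₀ (by positivity) (add_le_add hX hY) 2

end Summit.AtomisticToContinuum.BoseEinsteinCondensation.Cruxes.PeriodicIRBound.LinearPhFloorWagner.WF

end

namespace Summit.AtomisticToContinuum.BoseEinsteinCondensation.Cruxes.PeriodicIRBound.LinearPhFloorWagner

/-- **Stub 5b of the line `linear-ph-floor-wagner`**: the Wagner–Feynman moment bound `WagnerFeynmanBound` (with `A = 2`)
for every integrable admissible pair potential with the zero-momentum gap. -/
theorem stub_wagnerFeynman : WagnerFeynmanBound :=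
  ⟨2, two_pos, fun v hv hint hzmg => WF.wagnerFeynmanWith_two v hv hint hzmg⟩

end Summit.AtomisticToContinuum.BoseEinsteinCondensation.Cruxes.PeriodicIRBound.LinearPhFloorWagner
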